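import Literature.NumberTheory.Automorphic.CDTTheorem722
import Literature.NumberTheory.EllipticCurves.CMNewformGamma0PrimitiveIsNewformHolds
import Literature.NumberTheory.EllipticCurves.DeuringGrossencharacterHolds
import Literature.NumberTheory.EllipticCurves.HeckeThetaCMNewformGamma0Holds
import Literature.NumberTheory.EllipticCurves.ComplexMultiplicationDeuringConductor
import Literature.NumberTheory.EllipticCurves.LFunctionPrimeCoeff
import Literature.NumberTheory.EllipticCurves.NoEverywhereGoodReductionRat
import Literature.NumberTheory.EllipticCurves.SzpiroOfAbcProofs
import Literature.NumberTheory.EllipticCurves.DegreeConjectureAbcPrelims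
import Literature.NumberTheory.GaloisRepresentations.GrossencharakterPrimitive
import Literature.NumberTheory.GaloisRepresentations.HeckeCharacterConductor
import Literature.NumberTheory.GaloisRepresentations.CharacterNormalisedGeneratorHeckeCharacter
import Literature.FieldTheory.AlgClosed.PadicAlgClEquivComplex
import HarnessLib

/-!
# Stub-ideation k = 3, GENERATION 17 (home family 3 = PROBE THE EXTREMES) for `stub_liftThree`
# of crux `FreyModularity` (stmt-ABC-11340, route ABC/DefiniteXi, `Lines/Sketch.lean`, sha 21576c53)
# — THE CM CORNER: the extreme instance of the stub that the tree can now close UNCONDITIONALLY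

Companion of `STUB-IDEAS-stub_liftThree-3.md` (gen 17).  Nothing here is registered; the skeleton is
untouched.  NO `sorry`: helper STATEMENTS are `def … : Prop`, every `theorem` is PROVED.

The main road of the stub (Diamond 1996 Thm. 5.3 / CDT 7.2.1 at `ℓ = 3`, `9 ∤ N`: the k1/k2/k3 merged
adapter `LTW1 / H1 / H3″ / H4a` + socket `DiamondCSS62 3`, gens 12–16) is FACT-BLOCKED (no `R = T` in the
tree; 0 `_holds` for `CDT_theorem_7_2_1 / 7_1_2 / 7_2_2`, 2026-09-01T02:3xZ) and stays frozen by reference.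

Family 3e/3c ("perturb from the proved neighbouring case" / "the extreme instance"): since gen 16 the tree
gained `Deuring_exists_heckeCharacter_of_maximalCM_holds` (08-29) and
`shimura1972_heckeTheta_isNewform0_of_primitive_holds` (09-01 01:06Z).  With Hecke's theta cusp form
(`HeckeTheta.heckeThetaCuspForm_of_isGrossencharakter`, PROVED) they make the stub's conclusion
`W.IsModularGaloisRepTate 3` reachable WITHOUT any `R = T` for the nine maximal-CM `j`-invariants — the
`GL₁` corner of the stub (Frey instance: `{a, b, c} = {1, 1, -2}` ↦ `y² = x³ - x`, `N = 32`, `9 ∤ 32`,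
image of `ρ̄_{E,3}` = normaliser of a non-split Cartan ⊇ an element of order `8`, so the stub's `hirr`
holds there).  Below: six ONE-CYCLE helper statements H1–H6 over existing declarations and the PROVED
compositions `newformSupplyCM_of` (H2–H6 ⇒ a `Γ₀` newform pinned to every maximal-CM curve),
`cmCornerTate_of` (+ H1 ⇒ `IsModularGaloisRepTate ℓ` for every `ℓ`), `sigStubLiftThreeCM_of` (⇒ the stub
on the CM corner).  H1 (any-level automorphic output adapter) is ALSO the last arrow of the main road
(the `R = T` newform has level `N(ρ̄)·3^δ`, not `N_W`).  Honest label: zero leverage on the `∀`-stub.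
-/

set_option linter.dupNamespace false
set_option autoImplicit false

noncomputable section

open scoped MatrixGroups NumberField ModularForm
open NumberField NumberField.InfinitePlace IsDedekindDomain WeierstrassCurve CongruenceSubgroup
open Literature.NumberTheory Literature.NumberTheory.Automorphic Literature.NumberTheory.Automorphic.BCDT
open Literature.NumberTheory.GaloisRepresentations Literature.NumberTheory.GaloisRepresentations.ModPGaloisRep
open Literature.NumberTheory.EllipticCurves Literature.NumberTheory.EllipticCurves.ModularForms
open Literature.NumberTheory.LFunctions

namespace Summit.ABC.ABC.Cruxes.FreyModularity.StubIdeas.LiftThree3g17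

/-! ## §0 The registered stub (verbatim) and its CM corner -/

/-- The registered stub `stub_liftThree`, verbatim (`Lines/Sketch.lean` L157). [cite: Diamond1996, Thm. 5.4] -/
def SigStubLiftThree : Prop :=
  ∀ (W : WeierstrassCurve ℚ) [W.IsElliptic] (ρ : ModPGaloisRep ℚ (ZMod 3) 2),
    W.IsTorsionGaloisRep 3 ρ → ρ.IsAbsIrreducibleOverSqrt (-3) → ¬ 9 ∣ W.conductorNorm ℤ →
    ρ.IsModular → haveI : Fact (Nat.Prime 3) := ⟨Nat.prime_three⟩; W.IsModularGaloisRepTate 3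

/-- **The CM corner of the stub**: the stub restricted to curves with complex multiplication by a MAXIMAL
order (`W.j ∈ maximalCMJInvariants`, nine `j`-invariants; Frey member `y² = x³ - x`).  All four
hypotheses of the stub are kept (and are then irrelevant: the conclusion holds outright, `cmCornerTate_of`).
[cite: SilvermanATAEC1994, Ch. II Thm. 10.5] [cite: Shimura1971CMFactorsJacobians, Lemma 3] -/
def SigStubLiftThreeCM : Prop :=
  ∀ (W : WeierstrassCurve ℚ) [W.IsElliptic] (ρ : ModPGaloisRep ℚ (ZMod 3) 2),
    W.j ∈ maximalCMJInvariants →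
    W.IsTorsionGaloisRep 3 ρ → ρ.IsAbsIrreducibleOverSqrt (-3) → ¬ 9 ∣ W.conductorNorm ℤ →
    ρ.IsModular → haveI : Fact (Nat.Prime 3) := ⟨Nat.prime_three⟩; W.IsModularGaloisRepTate 3

/-- **Target of the corner, all primes `ℓ`, all models**: every elliptic curve over `ℚ` with CM by a
maximal order satisfies BCDT's condition (4) at every prime. [cite: BCDTJAMS2001, Introduction ((2) ⇒ (4))] -/
def CMCornerTate : Prop :=
  ∀ (W : WeierstrassCurve ℚ) [W.IsElliptic], W.j ∈ maximalCMJInvariants →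
    ∀ (ℓ : ℕ) [Fact ℓ.Prime], W.IsModularGaloisRepTate ℓ

/-- **Newform supply for maximal-CM curves (modularity, automorphic form, ANY level)**: a `Γ₀(M)` newform of
weight `2` whose level carries every bad prime and whose prime-indexed coefficients off `M` are the
Hasse–Weil coefficients `a_p(W)`.  (For the theta newform `M = |d_K|·N𝔣(ψ_{E/K})`, which IS `N_W` by
Deuring's conductor formula — not needed and not claimed here.) [cite: Shimura1971CMFactorsJacobians, Lemma 3]
[cite: SilvermanATAEC1994, Ch. II Thm. 10.5 (b)] -/
def NewformSupplyCM : Prop :=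
  ∀ (W : WeierstrassCurve ℚ) [W.IsElliptic], W.j ∈ maximalCMJInvariants →
    ∃ (M : ℕ) (_ : NeZero M) (g : CuspForm (Gamma0 M) 2), IsNewform0 g ∧
      (∀ (p : ℕ) [Fact p.Prime], ¬ p ∣ M → W.HasGoodReductionAtPrime p) ∧
      (∀ (p : ℕ) [Fact p.Prime], ¬ p ∣ M → cuspCoeff g p = ((W.LFunction p : ℤ) : ℂ))

/-! ## §1 The six one-cycle helper statements -/

/-- **H1 — automorphic OUTPUT ADAPTER at any level** (size S/M): a `Γ₀(M)` newform of weight `2` with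
`a_p(g) = a_p(W)` for the primes `p ∤ M·ℓ`, all of which are good for `W`, gives BCDT (4) at `ℓ`.  Proof =
the tree's `(2) ⇒ (4)` (`BCDT.IsModular.isModularGaloisRepTate`, CDTTheorem722 L281) with `N_W ↦ M`:
`liftToGamma1`, `isNewform1_liftToGamma1_iff_holds`, `nebentypus_liftToGamma1_holds`,
`smul_eq_of_mem_inertia_of_nsmul_eq_zero`, `trace_/det_galoisRepTate_frobenius_of_hasGoodReductionAt_holds`,
`lFunction_primesEquiv_eq_frobeniusTraceAt`; the coefficient field need NOT be `ℚ`: take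
`K := PadicAlgCl ℓ`, `ι := e.symm ∘ (K_g ⊆ ℂ)` with `e : PadicAlgCl ℓ ≃+* ℂ` from
`PadicAlgCl.nonempty_ringEquiv_complex` (integer Hecke polynomial is fixed by `e`).  Also the last arrow
of the MAIN road (the `R = T` newform has level `N(ρ̄)·ℓ^δ ≠ N_W` in general).
Cheapest failure: none known (pure bookkeeping); dies only if `coeffCharField` of the lift needs `IsNewform1`
facts not in tree — they are (`IsNewform1.numberField_coeffCharField`). [cite: BCDTJAMS2001, Introduction]
[cite: DiamondShurman2005, Thm. 9.4.1] -/
def NewformAnyLevelTate (ℓ : ℕ) [Fact ℓ.Prime] : Prop :=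
  ∀ (W : WeierstrassCurve ℚ) [W.IsElliptic] (M : ℕ) [NeZero M] (g : CuspForm (Gamma0 M) 2),
    IsNewform0 g →
    (∀ (p : ℕ) [Fact p.Prime], ¬ p ∣ M * ℓ → W.HasGoodReductionAtPrime p) →
    (∀ (p : ℕ) [Fact p.Prime], ¬ p ∣ M * ℓ → cuspCoeff g p = ((W.LFunction p : ℤ) : ℂ)) →
    W.IsModularGaloisRepTate ℓ

/-- **H2 — good reduction off `|d_K|·N𝔣(ψ)`** (size S/M): if `ψ` is unramified exactly at the primes of
good reduction of `E_K` (Deuring clause (iii)), then `E/ℚ` has good reduction at every `p ∤ d_K` prime to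
`N𝔣(ψ)`.  Proof: `p ∤ N𝔣 ⇒ 𝔣 ⊄ 𝔭_w` for `w ∣ p` (`Ideal.absNorm_dvd_absNorm_of_le`) ⇒ `ψ` unramified at `w`
(`HeckeCharacter.conductor_le_asIdeal_iff`) ⇒ `E_K` good at `w` ⇒ `f_w(E_K) = 0`
(`conductorExponent_eq_zero_iff_holds`) ⇒ `f_p(E) = 0` by UNRAMIFIED base change (`p ∤ d_K`,
`conductorExponent_baseChange_eq_of_ramificationIdx_eq_one`, PROVED) ⇒ good at `p`
(`hasGoodReductionAtPrime_primesEquiv_iff_hasGoodReductionAt`).  Cheapest failure: a maximal-CM curve with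
good reduction of `E_K` above a bad `p ∤ d_K` — impossible by the displayed chain.
[cite: SilvermanATAEC1994, Ch. II Thm. 9.2 (b); IV §11 proof of 11.1] -/
def GoodOffConductor : Prop :=
  ∀ (W : WeierstrassCurve ℚ) [W.IsElliptic] (K : Type) [Field K] [NumberField K] (ψ : HeckeCharacter K),
    Module.finrank ℚ K = 2 →
    (∀ w : HeightOneSpectrum (𝓞 K), ψ.IsUnramifiedAt w ↔ (W.baseChange K).HasGoodReductionAt w) →
    ∀ (p : ℕ) [Fact p.Prime], ¬ (p : ℤ) ∣ discr K → ¬ p ∣ Ideal.absNorm ψ.conductor →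
      W.HasGoodReductionAtPrime p

/-- **H3 — the conductor datum of an algebraic Hecke character is PRIMITIVE** (size S): `(𝔣(χ), v ↦ χ(ϖ_v))`
admits no Größencharakter of the same type modulo a proper divisor agreeing with it off `𝔣(χ)` — the
primitivity clause of `shimura1972_heckeTheta_isNewform0_of_primitive`.  Proof:
`IsGrossencharakter.primitive_of_conductor_eq` for the datum `hψ := isGrossencharakter_valueAtUniformizer_conductor'`,
after `heckeOfGross h𝔣 hψ = χ` (`HeckeCharacter.ext_of_eventually_valueAtUniformizer_eq` +
`heckeOfGross_valueAtUniformizer`) and `HeckeCharacter.conductor_def`.  Cheapest failure: none (Neukirch VII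
(6.11): the conductor is the smallest module of definition, all in tree). [cite: NeukirchANT1999, Ch. VII §6 (6.11), Cor. (6.14)] -/
def ConductorDatumPrimitive : Prop :=
  ∀ (K : Type) [Field K] [NumberField K] (χ : HeckeCharacter K) (p q : InfinitePlace K → ℤ),
    χ.HasInfinityType p q →
    ∀ (𝔣₁ : Ideal (𝓞 K)) (ψ₁ : HeightOneSpectrum (𝓞 K) → ℂ), χ.conductor ≤ 𝔣₁ →
      (∀ v : HeightOneSpectrum (𝓞 K), ¬ χ.conductor ≤ v.asIdeal → ψ₁ v = χ.valueAtUniformizer v) →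
      IsGrossencharakter 𝔣₁ p q ψ₁ → 𝔣₁ = χ.conductor

/-- Deuring's clause (iv), verbatim from `Deuring_exists_heckeCharacter_of_maximalCM` (the Frobenius data
of `ψ_{E/K}` at the good primes: split `a_p = ψ(w) + ψ(cw)`, `ψ(w)ψ(cw) = p`; inert `a_p = 0`, `ψ(w) = -p`).
[cite: SilvermanATAEC1994, Ch. II Ex. 2.30–2.32, Cor. 10.4.1] -/
def DeuringClauseIV (W : WeierstrassCurve ℚ) [W.IsGloballyMinimal] (K : Type) [Field K] [NumberField K]
    (c : K ≃ₐ[ℚ] K) (ψ : HeckeCharacter K) : Prop :=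
  ∀ (p : ℕ) [Fact p.Prime], W.HasGoodReductionAtPrime p →
    ∀ w : HeightOneSpectrum (𝓞 K), (p : 𝓞 K) ∈ w.asIdeal →
      ψ.IsUnramifiedAt w ∧
      (c • w ≠ w →
        ψ.valueAtUniformizer w + ψ.valueAtUniformizer (c • w) = (W.frobeniusTrace p : ℂ) ∧
        ψ.valueAtUniformizer w * ψ.valueAtUniformizer (c • w) = (p : ℂ)) ∧
      (c • w = w → W.frobeniusTrace p = 0 ∧ ψ.valueAtUniformizer w = -(p : ℂ))

/-- **H4 — the `Γ₀` (trivial-Nebentypus) clause for Deuring's `ψ`** (size M): `ψ̃((n)) = (d_K/n)·n` for odd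
`n` prime to `|d_K|·N𝔠`, granted that such primes are good.  Proof: `idealPow` is multiplicative
(`rayClassCoeffHom` / `idealPow_mul`), `(n) = ∏ (p)^e`; at a good `p ∤ d_K`: split `(p) = w·cw`, `c•w ≠ w`,
`ψ̃((p)) = ψ(w)ψ(cw) = p = (d_K/p)·p`; inert `(p) = w`, `c•w = w`, `ψ̃((p)) = ψ(w) = -p = (d_K/p)·p`
(clause (iv)); splitting ↔ `jacobiSym (discr K) p = ±1` (quadratic-field decomposition law, tree
`QuadraticFields/*`, `GrossPointsCount`).  Cheapest failure: a good prime `p ∣ n` ramified in `K` — excluded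
by `n.Coprime |d_K|`. [cite: Ribet1977Nebentypus, §3 Thm. (3.4)] [cite: SilvermanATAEC1994, Ch. II Ex. 2.30] -/
def DeuringNebentypus : Prop :=
  ∀ (W : WeierstrassCurve ℚ) [W.IsElliptic] [W.IsGloballyMinimal] (K : Type) [Field K] [NumberField K]
    (c : K ≃ₐ[ℚ] K) (ψ : HeckeCharacter K) (𝔠 : Ideal (𝓞 K)),
    Module.finrank ℚ K = 2 → IsTotallyComplex K → c ≠ 1 → DeuringClauseIV W K c ψ →
    (∀ (p : ℕ) [Fact p.Prime], ¬ (p : ℤ) ∣ discr K → ¬ p ∣ Ideal.absNorm 𝔠 → W.HasGoodReductionAtPrime p) →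
    ∀ n : ℕ, Odd n → n.Coprime ((discr K).natAbs * Ideal.absNorm 𝔠) →
      idealPow K (fun v => ψ.valueAtUniformizer v) (Ideal.span {(n : 𝓞 K)}) =
        (jacobiSym (discr K) n : ℂ) * (n : ℂ) ^ (2 - 1)

/-- **H5 — the theta coefficient at a good prime is `a_p(E)`** (size M): for `p ∤ d_K`, `p ∤ N𝔠`, `p` good:
`Σ_{N𝔞 = p, (𝔞,𝔠)=1} ψ̃(𝔞) = a_p`.  Proof: the ideals of norm `p` are `w, cw` (`c•w ≠ w`, split) — both prime
to `𝔠` since `p ∤ N𝔠`, `rayClassCoeff 𝔠 ψ̃ w = ψ(w)` — or none (inert: `N(p𝒪) = p²`); clause (iv) gives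
`ψ(w) + ψ(cw) = a_p`, resp. `a_p = 0`.  Tree shape of the norm-`p` sum: `∑ᶠ (w) (_ : absNorm w.asIdeal = ℓ), ψ w`
(BSD `exists_primitive_embCoeff_eq`, `RibetBadEulerFactor*`).  Cheapest failure: ramified `p` — excluded.
[cite: Ribet1977Nebentypus, §3 Cor. (3.5)] [cite: SilvermanATAEC1994, Ch. II Ex. 2.30 (b),(c)] -/
def ThetaGoodCoeff : Prop :=
  ∀ (W : WeierstrassCurve ℚ) [W.IsElliptic] [W.IsGloballyMinimal] (K : Type) [Field K] [NumberField K]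
    (c : K ≃ₐ[ℚ] K) (ψ : HeckeCharacter K) (𝔠 : Ideal (𝓞 K)),
    Module.finrank ℚ K = 2 → c ≠ 1 → DeuringClauseIV W K c ψ →
    ∀ (p : ℕ) [Fact p.Prime], ¬ (p : ℤ) ∣ discr K → ¬ p ∣ Ideal.absNorm 𝔠 → W.HasGoodReductionAtPrime p →
      (∑ᶠ J ∈ {J : Ideal (𝓞 K) | Ideal.absNorm J = p}, rayClassCoeff 𝔠 (fun v => ψ.valueAtUniformizer v) J) =
        (W.frobeniusTrace p : ℂ)

/-- **H6 — `cuspCoeff` from a `q`-expansion `HasSum`** (size S): PROVED verbatim in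
`Summits/BirchSwinnertonDyer/…/Theorems/SignedLowerHalvesRibetBadEulerFactorNewformCoefficients.lean`
(`cuspCoeff_eq_of_hasSum_theta`, 15 lines: `liftToGamma1`, `coe_liftToGamma1_holds`,
`ModularForms.qExpansion_coeff_eq_of_hasSum`); to be re-landed on the Literature side (cross-summit
Theorems are not imported here). [cite: DiamondShurman2005, §1.1] -/
def CuspCoeffOfHasSum : Prop :=
  ∀ (N : ℕ) [NeZero N] (k : ℤ) (g : CuspForm (Gamma0 N) k) (a : ℕ → ℂ),
    (∀ τ : UpperHalfPlane, HasSum (fun n : ℕ => a n * Complex.exp (2 * Real.pi * Complex.I * (τ : ℂ)) ^ n) (g τ)) →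
    ∀ n : ℕ, cuspCoeff g n = a n

/-! ## §2 Bookkeeping proved here -/

/-- An imaginary quadratic field has exactly one infinite place. [cite: NeukirchANT1999, Ch. I §5] -/
theorem subsingleton_infinitePlace {K : Type} [Field K] [NumberField K] (h2 : Module.finrank ℚ K = 2)
    (htc : IsTotallyComplex K) : Subsingleton (InfinitePlace K) := by
  haveI := htc
  have hcard : Fintype.card (InfinitePlace K) = 1 := by
    have h1 := IsTotallyComplex.finrank (K := K)
    have h3 := card_eq_nrRealPlaces_add_nrComplexPlaces (K := K)
    rw [IsTotallyComplex.nrRealPlaces_eq_zero, zero_add] at h3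
    omega
  exact Fintype.card_le_one_iff_subsingleton.mp hcard.le

/-- Every elliptic curve over `ℚ` has a `ℚ`-isomorphic globally minimal model `C • W`
(`exists_baseChange_int_forall_isMinimalAt`, `isGloballyMinimal_of_forall_isMinimalAt_int`).
[cite: SilvermanAEC2009, VIII.8 Cor. 8.3] -/
theorem exists_smul_isGloballyMinimal (W : WeierstrassCurve ℚ) [W.IsElliptic] :
    ∃ C : VariableChange ℚ, (C • W).IsGloballyMinimal := by
  obtain ⟨C, W₀, hCW, hmin⟩ := W.exists_baseChange_int_forall_isMinimalAt
  refine ⟨C, ?_⟩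
  rw [hCW]
  exact isGloballyMinimal_of_forall_isMinimalAt_int _ hmin

/-! ## §3 The proved compositions -/

/-- **H2 ∧ H3 ∧ H4 ∧ H5 ∧ H6 ⇒ newform supply for GLOBALLY MINIMAL maximal-CM curves** (the theta newform of
the conductor datum of Deuring's `ψ_{E/K}`; newness by Shimura 1971/72; level `|d_K|·N𝔣(ψ)`).
[cite: Shimura1971CMFactorsJacobians, Lemma 3] [cite: Ribet1977Nebentypus, §3 Remark (3.5)]
[cite: SilvermanATAEC1994, Ch. II Thm. 9.2, Thm. 10.5] -/
theorem exists_newform_of_isGloballyMinimal (h2 : GoodOffConductor) (h3 : ConductorDatumPrimitive)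
    (h4 : DeuringNebentypus) (h5 : ThetaGoodCoeff) (h6 : CuspCoeffOfHasSum)
    (W : WeierstrassCurve ℚ) [W.IsElliptic] [W.IsGloballyMinimal] (hj : W.j ∈ maximalCMJInvariants) :
    ∃ (M : ℕ) (_ : NeZero M) (g : CuspForm (Gamma0 M) 2), IsNewform0 g ∧
      (∀ (p : ℕ) [Fact p.Prime], ¬ p ∣ M → W.HasGoodReductionAtPrime p) ∧
      (∀ (p : ℕ) [Fact p.Prime], ¬ p ∣ M → cuspCoeff g p = ((W.LFunction p : ℤ) : ℂ)) := by
  classical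
  -- the CM field, its conjugation, Deuring's character
  obtain ⟨K, _, _, hK⟩ := exists_isCMFieldOfJ hj
  have hK2 : Module.finrank ℚ K = 2 := hK.1
  have htc : IsTotallyComplex K := IsCMFieldOfJ.isTotallyComplex hj hK
  obtain ⟨c, hc⟩ := GrossCurve.exists_algEquiv_ne_one (K := K) hK2
  obtain ⟨ψ, hinf, -, hiii, hiv, -⟩ := Deuring_exists_heckeCharacter_of_maximalCM_holds W hj K hK c hc
  -- the conductor datum `(𝔣(ψ), v ↦ ψ(ϖ_v))`, a Größencharakter of type `(1, 0)`
  have h𝔣 : ψ.conductor ≠ ⊥ := HeckeCharacter.conductor_ne_bot ψ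
  have hψG : IsGrossencharakter ψ.conductor (fun _ => (1 : ℤ)) (fun _ => (0 : ℤ))
      (fun v => ψ.valueAtUniformizer v) :=
    HeckeCharacter.isGrossencharakter_valueAtUniformizer_conductor' hinf
  -- the unique infinite place; the weight-2 spelling `σ^{2-1}` of the type `(1, 0)`
  haveI : Subsingleton (InfinitePlace K) := subsingleton_infinitePlace hK2 htc
  obtain ⟨w₀⟩ := (inferInstance : Nonempty (InfinitePlace K))
  have he : ∀ w : InfinitePlace K, w.embedding = w₀.embedding := fun w => by rw [Subsingleton.elim w w₀]
  obtain ⟨h10, h00⟩ := embType_eq_one_of_forall he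
  have htype1 : (fun w => (((2 : ℕ) : ℤ) - 1) * embType w₀.embedding w) = fun _ => (1 : ℤ) := by
    funext w; rw [h10]; norm_num
  have htype0 : (fun w => (((2 : ℕ) : ℤ) - 1) * embTypeConj w₀.embedding w) = fun _ => (0 : ℤ) := by
    funext w; rw [h00]; norm_num
  have hψG' : IsGrossencharakter ψ.conductor (fun w => (((2 : ℕ) : ℤ) - 1) * embType w₀.embedding w)
      (fun w => (((2 : ℕ) : ℤ) - 1) * embTypeConj w₀.embedding w) (fun v => ψ.valueAtUniformizer v) := by
    rw [htype1, htype0]; exact hψG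
  -- good reduction off `|d_K|·N𝔣`
  have hgood : ∀ (p : ℕ) [Fact p.Prime], ¬ (p : ℤ) ∣ discr K → ¬ p ∣ Ideal.absNorm ψ.conductor →
      W.HasGoodReductionAtPrime p := fun p _ hd hN => h2 W K ψ hK2 hiii p hd hN
  -- the Nebentypus clause and Hecke's theta cusp form on `Γ₀(|d_K|·N𝔣)`
  have hneb := h4 W K c ψ ψ.conductor hK2 htc hc hiv hgood
  have hc0 : Ideal.absNorm ψ.conductor ≠ 0 := by
    rw [Ne, Ideal.absNorm_eq_zero_iff]; exact h𝔣
  haveI hN₀ : NeZero ((discr K).natAbs * Ideal.absNorm ψ.conductor) :=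
    ⟨mul_ne_zero (Int.natAbs_ne_zero.mpr (NumberField.discr_ne_zero K)) hc0⟩
  obtain ⟨θ, hθ⟩ := HeckeTheta.heckeThetaCuspForm_of_isGrossencharakter K hK2 htc w₀.embedding 2 le_rfl
    even_two ψ.conductor h𝔣 _ hψG' hneb
  have hqθ : ∀ n : ℕ, 0 < n → cuspCoeff θ n =
      ∑ᶠ J ∈ {J : Ideal (𝓞 K) | Ideal.absNorm J = n}, rayClassCoeff ψ.conductor (fun v => ψ.valueAtUniformizer v) J :=
    fun n _ => h6 _ 2 θ (fun n => ∑ᶠ J ∈ {J : Ideal (𝓞 K) | Ideal.absNorm J = n},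
      rayClassCoeff ψ.conductor (fun v => ψ.valueAtUniformizer v) J) hθ n
  -- primitivity (H3) in the weight-2 spelling, and newness (Shimura, `_holds`)
  have hprim := h3 K ψ _ _ hinf
  have hprim' : ∀ (𝔣₁ : Ideal (𝓞 K)) (ψ₁ : HeightOneSpectrum (𝓞 K) → ℂ), ψ.conductor ≤ 𝔣₁ →
      (∀ v : HeightOneSpectrum (𝓞 K), ¬ ψ.conductor ≤ v.asIdeal → ψ₁ v = ψ.valueAtUniformizer v) →
      IsGrossencharakter 𝔣₁ (fun w => (((2 : ℕ) : ℤ) - 1) * embType w₀.embedding w)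
        (fun w => (((2 : ℕ) : ℤ) - 1) * embTypeConj w₀.embedding w) ψ₁ → 𝔣₁ = ψ.conductor := by
    intro 𝔣₁ ψ₁ hle hag hψ₁
    rw [htype1, htype0] at hψ₁
    exact hprim 𝔣₁ ψ₁ hle hag hψ₁
  have hnew : IsNewform0 θ :=
    shimura1972_heckeTheta_isNewform0_of_primitive_holds K hK2 htc w₀.embedding 2 le_rfl ψ.conductor h𝔣 _
      hψG' hprim' hneb θ hqθ
  -- divisibility bookkeeping off the level
  have hoff : ∀ p : ℕ, ¬ p ∣ (discr K).natAbs * Ideal.absNorm ψ.conductor →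
      ¬ (p : ℤ) ∣ discr K ∧ ¬ p ∣ Ideal.absNorm ψ.conductor := fun p hp =>
    ⟨fun h => hp (dvd_mul_of_dvd_left (Int.ofNat_dvd_left.mp h) _), fun h => hp (dvd_mul_of_dvd_right h _)⟩
  refine ⟨(discr K).natAbs * Ideal.absNorm ψ.conductor, hN₀, θ, hnew, fun p _ hp => ?_, fun p _ hp => ?_⟩
  · exact hgood p (hoff p hp).1 (hoff p hp).2
  · have hgp : W.HasGoodReductionAtPrime p := hgood p (hoff p hp).1 (hoff p hp).2
    rw [hqθ p (Fact.out : p.Prime).pos, h5 W K c ψ ψ.conductor hK2 hc hiv p (hoff p hp).1 (hoff p hp).2 hgp,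
      LFunction_apply_prime_eq_frobeniusTrace W p hgp]

/-- **H2–H6 ⇒ `NewformSupplyCM`** (all models: transport along a globally minimal `C • W` by the tree's
isomorphism invariance of `j`, `L(W, s)` and good reduction: `variableChange_j`, `LFunction_smul`,
`hasGoodReductionAtPrime_iff_of_variableChange`). [cite: SilvermanAEC2009, VII.1 Prop. 1.3 (b), App. C §16] -/
theorem newformSupplyCM_of (h2 : GoodOffConductor) (h3 : ConductorDatumPrimitive) (h4 : DeuringNebentypus)
    (h5 : ThetaGoodCoeff) (h6 : CuspCoeffOfHasSum) : NewformSupplyCM := by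
  intro W _ hj
  obtain ⟨C, hM⟩ := exists_smul_isGloballyMinimal W
  haveI := hM
  have hj' : (C • W).j ∈ maximalCMJInvariants := by rwa [variableChange_j]
  obtain ⟨M, hM0, g, hg, hgood, hcoef⟩ := exists_newform_of_isGloballyMinimal h2 h3 h4 h5 h6 (C • W) hj'
  refine ⟨M, hM0, g, hg, fun p _ hp => ?_, fun p _ hp => ?_⟩
  · exact (hasGoodReductionAtPrime_iff_of_variableChange W C p).mp (hgood p hp)
  · rw [hcoef p hp, LFunction_smul]

/-- ★ **(∀ ℓ, H1 ℓ) ∧ H2 ∧ … ∧ H6 ⇒ the CM corner at every prime**: every elliptic curve over `ℚ` with CM by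
a maximal order satisfies `IsModularGaloisRepTate ℓ` — with NO `R = T`, NO Langlands–Tunnell, NO named fact
beyond the two `_holds` theorems.  First in-tree inhabitant of the stub's conclusion once H1–H6 land.
[cite: BCDTJAMS2001, Introduction ((2) ⇒ (4))] [cite: Shimura1971CMFactorsJacobians, Lemma 3] -/
theorem cmCornerTate_of (h1 : ∀ (ℓ : ℕ) [Fact ℓ.Prime], NewformAnyLevelTate ℓ) (h2 : GoodOffConductor)
    (h3 : ConductorDatumPrimitive) (h4 : DeuringNebentypus) (h5 : ThetaGoodCoeff) (h6 : CuspCoeffOfHasSum) :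
    CMCornerTate := by
  intro W _ hj ℓ _
  obtain ⟨M, hM0, g, hg, hgood, hcoef⟩ := newformSupplyCM_of h2 h3 h4 h5 h6 W hj
  exact h1 ℓ W M g hg (fun p _ hp => hgood p fun h => hp (dvd_mul_of_dvd_left h _))
    (fun p _ hp => hcoef p fun h => hp (dvd_mul_of_dvd_left h _))

/-- ★ **The CM corner of `stub_liftThree`, from `CMCornerTate`** (the stub's four hypotheses are not used).
[cite: Diamond1996, Thm. 5.4] -/
theorem sigStubLiftThreeCM_of (h : CMCornerTate) : SigStubLiftThreeCM := by
  intro W _ ρ hj _ _ _ _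
  exact h W hj 3

/-- (sanity) the corner is literally the stub plus one hypothesis. [folklore] -/
theorem sigStubLiftThreeCM_of_stub (h : SigStubLiftThree) : SigStubLiftThreeCM :=
  fun W _ ρ _ hρ hirr h9 hmod => h W ρ hρ hirr h9 hmod

/-! ## §4 Pins: the tree inputs this companion leans on (elaboration = they exist with these names) -/

example := @Deuring_exists_heckeCharacter_of_maximalCM_holds
example := @shimura1972_heckeTheta_isNewform0_of_primitive_holds
example := @HeckeTheta.heckeThetaCuspForm_of_isGrossencharakter
example := @IsGrossencharakter.primitive_of_conductor_eq
example := @HeckeCharacter.isGrossencharakter_valueAtUniformizer_conductor'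
example := @conductorExponent_baseChange_eq_of_ramificationIdx_eq_one
example := @PadicAlgCl.nonempty_ringEquiv_complex
example := @BCDT.IsModular.isModularGaloisRepTate

end Summit.ABC.ABC.Cruxes.FreyModularity.StubIdeas.LiftThree3g17

end
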